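import Summits.CriticalPhenomena.PercolationContinuityZ3.Theorems.PercNearOneGluingNoHeavyPcintWinKernelSymCert
import Summits.CriticalPhenomena.PercolationContinuityZ3.Theorems.PercNearOneGluingNoHeavyPcintWinKernelRange
import HarnessLib

/-!
# PCINT lane, kernel B2r window certificate `d = 6`, memory 5 (4-step windows, 20736 codes) — table and chunk check

Cell `prim-pcint`, seat `prim-pcint-2` (gen 2); memo `run/shared/lean/prim/pcint/REDUCTIONS.md` §B2r, INTERVAL-PLAN §14.
Does NOT build on p205010.  Instance data for the generic theorem
`WinK.le_siteCriticalProb_of_checkSK`: `p = 1001/10^4`, `q̄ = 9905/10^4` (`q̄^11 ≥ 1-p`), `κ̄ = (10^4+9905)/(2·10^4)`; Collatz–Wielandt vector on the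
17 hyperoctahedral normal forms keyed by the Gram code of the window (integer scale `10^5`, found by power iteration and verified in exact arithmetic
off-line: max row ratio `2794353499/2796000000` < 1; `λ = 99999/10^5`).  The `20736` coded rows are checked (only on first-use normal forms, WinK.isNF) by `decide +kernel` in
`…KernZ6S5Check*`; result in `…KernZ6S5`: `p_c^site(ℤ⁶) ≥ 0.1001`.
-/

namespace Summit.CriticalPhenomena.PercolationContinuityZ3.Theorems.Pcint

namespace Z6S5

set_option maxRecDepth 4000 in
/-- Certificate table, chunk 1/1 (`Gram code ↦ v`). [folklore] -/
def tbl1 : List (ℕ × ℕ) := [(14408200, 89357), (14408284, 89357), (14414770, 89357), (14428612, 90270), (14435266, 90270), (14939668, 89357), (14960080, 90270), (15471136, 81362), (15491548, 90270), (16004710, 90270), (16011280, 90270), (16536262, 90270), (19368316, 99957), (19368400, 99957), (19906354, 99957), (20985238, 100000), (21523360, 100000)]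


/-- The certificate table `Gram code ↦ v` (concatenation of the chunks). [folklore] -/
def tbl : List (ℕ × ℕ) := tbl1

/-- All table values lie in `[81362, 100000]`. [folklore] -/
theorem tbl_bounds : ∀ e ∈ tbl, 81362 ≤ e.2 ∧ e.2 ≤ 100000 := by decide +kernel

/-- The Collatz–Wielandt row check on the window codes `[lo, hi)`. [folklore] -/
def chk (lo hi : ℕ) : Bool := WinK.allRange (WinK.nfOKS 6 3 1001 9905 99999 tbl 81362) lo hi

/-- Splitting a chunk check. [folklore] -/
theorem chk_split {lo mid hi : ℕ} (h1 : chk lo mid = true) (h2 : chk mid hi = true) : chk lo hi = true :=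
  WinK.allRange_split h1 h2

end Z6S5

end Summit.CriticalPhenomena.PercolationContinuityZ3.Theorems.Pcint
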